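/-
Copyright (c) 2026 the pub-hodgecm-mathlib formalisation cell (harness21).  Prover seat hodgecm-mathlib-F0P2-p01 (g26); E1 keeper ∕ dealer
F0P3a-p03 (g29) (E1 ledger row 36 «THE KERNEL OF THE FROBENIUS UNIT IS `r_P`-NULL», LEAD F0P3a-plan (g16) rule-20 generic brick); 2026-09-03.
-/
import Literature.NumberTheory.Automorphic.SmoothInductionFrobeniusNaturality   -- ★ FN p852974: `frobeniusNormalized_apply_mk`, `frobeniusNormalized_symm_apply` (+ ★ `JacquetModuleFrobeniusProofs`, ★ `SmoothInduction`)
import Literature.NumberTheory.Automorphic.JacquetModuleExactProofs             -- ★ `jacquetMap_injective` (left exactness of `r_P`, [BernsteinZelevinsky1977, Prop. 1.9 (a)])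
import HarnessLib

/-!
# The kernel of the Frobenius unit `E → i_P^G(r_P E)` has zero Jacquet module (Bernstein–Zelevinsky 1977 §1.9; Casselman 1995 §3.2)

Topic `NumberTheory/Automorphic`; namespace `Representation` (dot-notation neighbourhood of ★ `Representation.frobeniusEquiv` ∕ ★ `normalizedJacquetHomEquiv` ∕
★ `jacquetMap`, beside ★ `SmoothInductionFrobeniusNaturality`).  THEOREMS ONLY (no definition, no instance, no notation, no named fact, no `sorry`).

THE MATHEMATICS.  `t = (P, M, N)` a parabolic triple with `δ_P|_N = 1` (`hδ`), `π` a SMOOTH representation of `G` on `V`, `σ` a representation of `M`.  The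
normalised Frobenius equivalence `E = (frobeniusEquiv hπ).trans (normalizedJacquetHomEquiv t π σ hδ) : Hom_G(π, i_P^G σ) ≃ Hom_M(r_P π, σ)` (★
`frobenius_normalizedInd_holds`; `E(Φ)([v]) = (Φ v)(1)`, ★ `frobeniusNormalized_apply_mk`) attaches to `Φ : π → i_P^G σ` its ADJOINT `E Φ : r_P π → σ`; the UNIT of the
adjunction is `η = E⁻¹(id_{r_P π}) : π → i_P^G(r_P π)`, `(η v)(g) = [π(g) v]` (★ `frobeniusNormalized_symm_apply`), and the COUNIT is `ε_σ = E(id_{i_P σ}) : r_P(i_P^G σ) → σ`,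
`ε_σ [F] = F(1)`.
* §1 `toFun_apply_eq_adjoint_mk`: `(Φ v)(g) = (E Φ)[π(g) v]` (equivariance of `Φ`); `mem_ker_iff_forall_adjoint_mk`: `Φ v = 0 ⟺ ∀ g, (E Φ)[π(g) v] = 0`; for an INJECTIVE
  adjoint, `mem_ker_iff_forall_mk_eq_zero`: `Φ v = 0 ⟺ ∀ g, [π(g) v] = 0`, and `mk_eq_zero_of_mem_ker`: `[v] = 0` on `ker Φ`.
* §2 TRIANGLE: `counit_mk` (`ε_σ [F] = F(1)`), **`counit_comp_jacquetMap`** (`ε_σ ∘ r_P(Φ) = E Φ` on underlying linear maps — the adjunction triangle; with `Φ = η` it reads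
  `ε ∘ r_P(η) = id`, so `r_P(η)` is a SPLIT MONOMORPHISM), **`jacquetMap_injective_of_adjoint_injective`** (`E Φ` injective ⟹ `r_P(Φ)` injective — NO exactness used).
* §3 **`mk_ker_eq_zero`** («THE KERNEL IS `r_P`-NULL»): if `N` is the union of its compact open subgroups (`hN`, left exactness of `r_P`, ★ `jacquetMap_injective`) and the
  adjoint `E Φ` is injective, every class of the Jacquet module OF THE SUBREPRESENTATION `ker Φ` vanishes: `r_P(ker Φ) = 0`; `subsingleton_coinvariants_ker`.
* §4 **`injective_of_forall_exists_mk_ne_zero`**: if moreover every non-zero subrepresentation `W ≤ π` has a non-zero Jacquet class (`hfaith`; e.g. `π` of finite length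
  without `r_P`-null constituents), then `Φ` is INJECTIVE — «`E ≅ Φ(E) ⊂ i_P^G σ`».
* §5 THE UNIT (`Φ = η = E⁻¹ id`, adjoint `id` injective): `unit_toFun` (`(η v)(g) = [π(g) v]`), `mem_ker_unit_iff`, `jacquetMap_unit_injective`, `mk_ker_unit_eq_zero`,
  **`unit_injective_of_forall_exists_mk_ne_zero`**.
Everything is stated for a `Φ` and its adjoint `E Φ` (equivalently for `ψ : r_P π → σ` and `E⁻¹ ψ`, `E` being an equivalence), so that no bundled «unit» constructor is introduced.
Consumer (cell `pub/hodgecm-mathlib`, crux H413, E1 column, RESIDUE MATRIX v1.1 K2′-π² cell «`r_B E ≅ N`»): the injectivity of `E → i_B(r_B E)` for a length-two `E` with no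
`r_B`-null constituent.  HONEST LABEL: count-neutral generic base layer; HC_CM is proved only modulo the printed citations until rung 0 closes.

## References
* [BernsteinZelevinsky1977] I. N. Bernstein, A. V. Zelevinsky, *Induced representations of reductive p-adic groups I*, Ann. Sci. ÉNS 10 (1977), §1.8 (the functors `i`, `r`),
  Prop. 1.9 (a) (exactness of `r`), (b) (adjunction `Hom(r π, ρ) = Hom(π, i ρ)`).
* [BernsteinZelevinsky1976] I. N. Bernstein, A. V. Zelevinsky, Russian Math. Surveys 31:3 (1976), Prop. 2.28 (Frobenius reciprocity), Prop. 2.35 (exactness).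
* [Casselman1995] W. Casselman, *Introduction to the theory of admissible representations of p-adic reductive groups* (1995), §3.2, Prop. 3.2.3, Thm. 3.2.4.
-/

set_option autoImplicit false

noncomputable section

namespace Representation

open Literature.NumberTheory.Automorphic

variable {G : Type*} [Group G] [TopologicalSpace G] [IsTopologicalGroup G]
  (t : ParabolicTriple G) [LocallyCompactSpace t.P]
  {V W : Type*} [AddCommGroup V] [Module ℂ V] [AddCommGroup W] [Module ℂ W]
  {π : Representation ℂ G V} (σ : Representation ℂ t.M W)

/-! ## §1 The kernel of `Φ : π → i_P^G σ` through its adjoint `E Φ : r_P π → σ` -/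

section Kernel

/-- **`(Φ v)(g) = (E Φ)[π(g) v]`**: a `G`-map into `i_P^G σ` is recovered from its adjoint — `(Φ v)(g) = (Φ v)(1·g) = (Φ(π(g) v))(1)` by equivariance
(★ `toFun_smoothIndRep_apply`) and `(E Φ)[w] = (Φ w)(1)` (★ `frobeniusNormalized_apply_mk`). [cite: BernsteinZelevinsky1977, Proposition 1.9(b), p. 445]
[cite: BernsteinZelevinsky1976, Proposition 2.28] -/
theorem toFun_apply_eq_adjoint_mk (hπ : π.IsSmooth)
    (hδ : ∀ (n : G) (hn : n ∈ t.N), deltaChar t.P ⟨n, t.N_le hn⟩ = 1)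
    (Φ : π.IntertwiningMap (Representation.normalizedInd t σ)) (v : V) (g : G) :
    (Φ v).toFun g =
      ((frobeniusEquiv (H := t.P) (σ := Representation.twist (σ.comp t.proj) (rootDeltaChar t.P)) hπ).trans
        (normalizedJacquetHomEquiv t π σ hδ)) Φ (Coinvariants.mk (t.restrict π) (π g v)) := by
  rw [frobeniusNormalized_apply_mk, Φ.isIntertwining]
  change (Φ v).toFun g = (smoothIndRep t.P _ g (Φ v)).toFun 1
  rw [toFun_smoothIndRep_apply, one_mul]

/-- **`Φ v = 0 ⟺ ∀ g, (E Φ)[π(g) v] = 0`**: the kernel of `Φ : π → i_P^G σ` read on the adjoint. [cite: BernsteinZelevinsky1977, Proposition 1.9(b), p. 445]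
[cite: Casselman1995, §3.2] -/
theorem mem_ker_iff_forall_adjoint_mk (hπ : π.IsSmooth)
    (hδ : ∀ (n : G) (hn : n ∈ t.N), deltaChar t.P ⟨n, t.N_le hn⟩ = 1)
    (Φ : π.IntertwiningMap (Representation.normalizedInd t σ)) (v : V) :
    v ∈ Φ.ker ↔ ∀ g : G,
      ((frobeniusEquiv (H := t.P) (σ := Representation.twist (σ.comp t.proj) (rootDeltaChar t.P)) hπ).trans
        (normalizedJacquetHomEquiv t π σ hδ)) Φ (Coinvariants.mk (t.restrict π) (π g v)) = 0 := by
  rw [IntertwiningMap.mem_ker]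
  constructor
  · intro h g
    rw [← toFun_apply_eq_adjoint_mk t σ hπ hδ Φ v g, h]
    rfl
  · intro h
    apply SmoothInd.ext
    funext g
    rw [toFun_apply_eq_adjoint_mk t σ hπ hδ Φ v g, h g]
    rfl

/-- **For an INJECTIVE adjoint, `Φ v = 0 ⟺ ∀ g, [π(g) v] = 0`** — the kernel of `Φ` is the largest subrepresentation of `π` contained in the kernel `V(N)` of `V → V_N`; in
particular it does not depend on `σ` or `Φ` (it is the kernel of the UNIT, §5). [cite: BernsteinZelevinsky1977, §1.9] [cite: Casselman1995, §3.2] -/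
theorem mem_ker_iff_forall_mk_eq_zero (hπ : π.IsSmooth)
    (hδ : ∀ (n : G) (hn : n ∈ t.N), deltaChar t.P ⟨n, t.N_le hn⟩ = 1)
    (Φ : π.IntertwiningMap (Representation.normalizedInd t σ))
    (hinj : Function.Injective
      (((frobeniusEquiv (H := t.P) (σ := Representation.twist (σ.comp t.proj) (rootDeltaChar t.P)) hπ).trans
        (normalizedJacquetHomEquiv t π σ hδ)) Φ))
    (v : V) :
    v ∈ Φ.ker ↔ ∀ g : G, Coinvariants.mk (t.restrict π) (π g v) = 0 := by
  rw [mem_ker_iff_forall_adjoint_mk t σ hπ hδ Φ v]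
  refine forall_congr' fun g => ⟨fun h => hinj (by rw [h, map_zero]), fun h => by rw [h, map_zero]⟩

/-- On the kernel of a `Φ` with injective adjoint, every vector has ZERO class in `r_P π` (`g = 1` in `mem_ker_iff_forall_mk_eq_zero`). [cite: BernsteinZelevinsky1977, §1.9]
[cite: Casselman1995, §3.2] -/
theorem mk_eq_zero_of_mem_ker (hπ : π.IsSmooth)
    (hδ : ∀ (n : G) (hn : n ∈ t.N), deltaChar t.P ⟨n, t.N_le hn⟩ = 1)
    (Φ : π.IntertwiningMap (Representation.normalizedInd t σ))
    (hinj : Function.Injective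
      (((frobeniusEquiv (H := t.P) (σ := Representation.twist (σ.comp t.proj) (rootDeltaChar t.P)) hπ).trans
        (normalizedJacquetHomEquiv t π σ hδ)) Φ))
    {v : V} (hv : v ∈ Φ.ker) :
    Coinvariants.mk (t.restrict π) v = 0 := by
  have h := (mem_ker_iff_forall_mk_eq_zero t σ hπ hδ Φ hinj v).1 hv 1
  rwa [map_one, Module.End.one_apply] at h

end Kernel

/-! ## §2 The triangle identity: `ε_σ ∘ r_P(Φ) = E Φ`; `r_P(Φ)` is injective when the adjoint is -/

section Triangle

/-- **The COUNIT `ε_σ = E(id) : r_P(i_P^G σ) → σ` is evaluation at `1`**: `ε_σ [F] = F(1)`. [cite: BernsteinZelevinsky1977, Proposition 1.9(b), p. 445]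
[cite: Casselman1995, Thm. 3.2.4] -/
theorem counit_mk (hδ : ∀ (n : G) (hn : n ∈ t.N), deltaChar t.P ⟨n, t.N_le hn⟩ = 1)
    (F : SmoothInd t.P (Representation.twist (σ.comp t.proj) (rootDeltaChar t.P))) :
    ((frobeniusEquiv (H := t.P) (σ := Representation.twist (σ.comp t.proj) (rootDeltaChar t.P))
          (isSmooth_smoothInd t.P (Representation.twist (σ.comp t.proj) (rootDeltaChar t.P)))).trans
        (normalizedJacquetHomEquiv t (Representation.normalizedInd t σ) σ hδ))
      (IntertwiningMap.id (Representation.normalizedInd t σ)) (Coinvariants.mk (t.restrict (Representation.normalizedInd t σ)) F) = F.toFun 1 :=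
  rfl

/-- **THE TRIANGLE IDENTITY `ε_σ ∘ r_P(Φ) = E Φ`** (underlying linear maps; `r_P(Φ) = jacquetMap t Φ`, `[v] ↦ [Φ v]`): `ε_σ [Φ v] = (Φ v)(1) = (E Φ)[v]`.  With `Φ = η` the unit
(`E η = id`) it is the adjunction triangle `ε ∘ r_P(η) = id_{r_P π}`: **`r_P(η)` is a split monomorphism**. [cite: BernsteinZelevinsky1977, Proposition 1.9(b), p. 445]
[cite: Casselman1995, Thm. 3.2.4] -/
theorem counit_comp_jacquetMap (hπ : π.IsSmooth)
    (hδ : ∀ (n : G) (hn : n ∈ t.N), deltaChar t.P ⟨n, t.N_le hn⟩ = 1)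
    (Φ : π.IntertwiningMap (Representation.normalizedInd t σ)) :
    (((frobeniusEquiv (H := t.P) (σ := Representation.twist (σ.comp t.proj) (rootDeltaChar t.P))
          (isSmooth_smoothInd t.P (Representation.twist (σ.comp t.proj) (rootDeltaChar t.P)))).trans
        (normalizedJacquetHomEquiv t (Representation.normalizedInd t σ) σ hδ))
      (IntertwiningMap.id (Representation.normalizedInd t σ))).toLinearMap ∘ₗ (jacquetMap t Φ).toLinearMap =
      (((frobeniusEquiv (H := t.P) (σ := Representation.twist (σ.comp t.proj) (rootDeltaChar t.P)) hπ).trans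
        (normalizedJacquetHomEquiv t π σ hδ)) Φ).toLinearMap := by
  refine Coinvariants.hom_ext (LinearMap.ext fun v => ?_)
  rfl

/-- **`E Φ` injective ⟹ `r_P(Φ) : r_P π → r_P(i_P^G σ)` injective** (from the triangle `ε_σ ∘ r_P(Φ) = E Φ`; no exactness of `r_P` is used).  In particular `r_P` of the UNIT is
injective (§5). [cite: BernsteinZelevinsky1977, Proposition 1.9(b), p. 445] [cite: Casselman1995, Thm. 3.2.4] -/
theorem jacquetMap_injective_of_adjoint_injective (hπ : π.IsSmooth)
    (hδ : ∀ (n : G) (hn : n ∈ t.N), deltaChar t.P ⟨n, t.N_le hn⟩ = 1)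
    (Φ : π.IntertwiningMap (Representation.normalizedInd t σ))
    (hinj : Function.Injective
      (((frobeniusEquiv (H := t.P) (σ := Representation.twist (σ.comp t.proj) (rootDeltaChar t.P)) hπ).trans
        (normalizedJacquetHomEquiv t π σ hδ)) Φ)) :
    Function.Injective (jacquetMap t Φ) := by
  intro x y hxy
  apply hinj
  have h := congrArg (fun f : (t.restrict π).Coinvariants →ₗ[ℂ] W => f x) (counit_comp_jacquetMap t σ hπ hδ Φ)
  have h' := congrArg (fun f : (t.restrict π).Coinvariants →ₗ[ℂ] W => f y) (counit_comp_jacquetMap t σ hπ hδ Φ)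
  simp only [LinearMap.coe_comp, Function.comp_apply, IntertwiningMap.toLinearMap_apply] at h h'
  rw [← h, ← h', hxy]

end Triangle

/-! ## §3 «THE KERNEL IS `r_P`-NULL»: `r_P(ker Φ) = 0` for an injective adjoint (left exactness of `r_P`) -/

section Null

/-- **The Jacquet module of `ker Φ` vanishes** when the adjoint `E Φ` is injective, `π` is smooth and `N` is the union of its compact open subgroups: the inclusion `ker Φ ↪ π`
induces an INJECTION `r_P(ker Φ) → r_P π` (★ `jacquetMap_injective`, [BernsteinZelevinsky1977, Prop. 1.9 (a)]) whose image is `{[v] : v ∈ ker Φ} = 0` (§1).  So every class of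
`r_P(ker Φ)` — the Jacquet module of the SUBREPRESENTATION, not merely its image in `r_P π` — is zero. [cite: BernsteinZelevinsky1977, Prop. 1.9 (a)–(b), p. 445]
[cite: Casselman1995, Prop. 3.2.3, Thm. 3.2.4] -/
theorem mk_ker_eq_zero (hN : IsLimitOfCompactOpen t.N) (hπ : π.IsSmooth)
    (hδ : ∀ (n : G) (hn : n ∈ t.N), deltaChar t.P ⟨n, t.N_le hn⟩ = 1)
    (Φ : π.IntertwiningMap (Representation.normalizedInd t σ))
    (hinj : Function.Injective
      (((frobeniusEquiv (H := t.P) (σ := Representation.twist (σ.comp t.proj) (rootDeltaChar t.P)) hπ).trans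
        (normalizedJacquetHomEquiv t π σ hδ)) Φ))
    (w : ↥Φ.ker.toSubmodule) :
    Coinvariants.mk (t.restrict Φ.ker.toRepresentation) w = 0 := by
  -- the inclusion `ker Φ ↪ π` as an intertwining map
  let ι : Φ.ker.toRepresentation.IntertwiningMap π := ⟨Φ.ker.toSubmodule.subtype, fun g => LinearMap.ext fun _ => rfl⟩
  have hι : Function.Injective ι := Subtype.val_injective
  have hinjr := jacquetMap_injective t hN hπ ι hι
  apply hinjr
  rw [jacquetMap_mk, map_zero]
  exact mk_eq_zero_of_mem_ker t σ hπ hδ Φ hinj w.2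

/-- `r_P(ker Φ) = 0` as a `Subsingleton` (the form of ★ `Representation.IsCuspidalRep`). [cite: BernsteinZelevinsky1977, Prop. 1.9 (a)–(b), p. 445] -/
theorem subsingleton_coinvariants_ker (hN : IsLimitOfCompactOpen t.N) (hπ : π.IsSmooth)
    (hδ : ∀ (n : G) (hn : n ∈ t.N), deltaChar t.P ⟨n, t.N_le hn⟩ = 1)
    (Φ : π.IntertwiningMap (Representation.normalizedInd t σ))
    (hinj : Function.Injective
      (((frobeniusEquiv (H := t.P) (σ := Representation.twist (σ.comp t.proj) (rootDeltaChar t.P)) hπ).trans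
        (normalizedJacquetHomEquiv t π σ hδ)) Φ)) :
    Subsingleton (t.restrict Φ.ker.toRepresentation).Coinvariants := by
  refine ⟨fun x y => ?_⟩
  obtain ⟨w, rfl⟩ := Coinvariants.mk_surjective _ x
  obtain ⟨w', rfl⟩ := Coinvariants.mk_surjective _ y
  rw [mk_ker_eq_zero t σ hN hπ hδ Φ hinj w, mk_ker_eq_zero t σ hN hπ hδ Φ hinj w']

end Null

/-! ## §4 Injectivity of `Φ` when `π` has no `r_P`-null subrepresentation -/

section Injective

/-- **`Φ` is INJECTIVE when its adjoint is injective and every non-zero subrepresentation of `π` has a non-zero Jacquet class** (`hfaith`; e.g. `π` of finite length all of whose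
constituents have `r_P ≠ 0`): by §3 the kernel is `r_P`-null, so it is `⊥` — «`E ≅ Φ(E) ⊂ i_P^G σ`». [cite: BernsteinZelevinsky1977, Prop. 1.9 (a)–(b), p. 445]
[cite: Casselman1995, Prop. 3.2.3, Thm. 3.2.4] -/
theorem injective_of_forall_exists_mk_ne_zero (hN : IsLimitOfCompactOpen t.N) (hπ : π.IsSmooth)
    (hδ : ∀ (n : G) (hn : n ∈ t.N), deltaChar t.P ⟨n, t.N_le hn⟩ = 1)
    (Φ : π.IntertwiningMap (Representation.normalizedInd t σ))
    (hinj : Function.Injective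
      (((frobeniusEquiv (H := t.P) (σ := Representation.twist (σ.comp t.proj) (rootDeltaChar t.P)) hπ).trans
        (normalizedJacquetHomEquiv t π σ hδ)) Φ))
    (hfaith : ∀ U : Subrepresentation π, U ≠ ⊥ → ∃ w : ↥U.toSubmodule, Coinvariants.mk (t.restrict U.toRepresentation) w ≠ 0) :
    Function.Injective Φ := by
  have hbot : Φ.ker = ⊥ := by
    by_contra hne
    obtain ⟨w, hw⟩ := hfaith Φ.ker hne
    exact hw (mk_ker_eq_zero t σ hN hπ hδ Φ hinj w)
  intro x y hxy
  have hmem : x - y ∈ Φ.ker := by rw [IntertwiningMap.mem_ker, map_sub, hxy, sub_self]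
  rw [hbot] at hmem
  have h0 : x - y ∈ (⊥ : Subrepresentation π).toSubmodule := hmem
  change x - y ∈ (⊥ : Submodule ℂ V) at h0
  rw [Submodule.mem_bot, sub_eq_zero] at h0
  exact h0

end Injective

/-! ## §5 The UNIT `η = E⁻¹(id) : π → i_P^G(r_P π)` -/

section Unit

/-- **`(η v)(g) = [π(g) v]`** for the unit `η = E⁻¹(id_{r_P π})` (★ `frobeniusNormalized_symm_apply`). [cite: BernsteinZelevinsky1977, Proposition 1.9(b), p. 445] -/
theorem unit_toFun (hπ : π.IsSmooth)
    (hδ : ∀ (n : G) (hn : n ∈ t.N), deltaChar t.P ⟨n, t.N_le hn⟩ = 1) (v : V) (g : G) :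
    ((((frobeniusEquiv (H := t.P) (σ := Representation.twist ((π.normalizedJacquet t).comp t.proj) (rootDeltaChar t.P)) hπ).trans
        (normalizedJacquetHomEquiv t π (π.normalizedJacquet t) hδ)).symm (IntertwiningMap.id (π.normalizedJacquet t))) v).toFun g =
      Coinvariants.mk (t.restrict π) (π g v) :=
  rfl

/-- The adjoint of the unit is `id` (so it is injective): `E(E⁻¹ id) = id`. [cite: BernsteinZelevinsky1977, Proposition 1.9(b), p. 445] -/
theorem adjoint_unit (hπ : π.IsSmooth)
    (hδ : ∀ (n : G) (hn : n ∈ t.N), deltaChar t.P ⟨n, t.N_le hn⟩ = 1) :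
    ((frobeniusEquiv (H := t.P) (σ := Representation.twist ((π.normalizedJacquet t).comp t.proj) (rootDeltaChar t.P)) hπ).trans
        (normalizedJacquetHomEquiv t π (π.normalizedJacquet t) hδ))
      (((frobeniusEquiv (H := t.P) (σ := Representation.twist ((π.normalizedJacquet t).comp t.proj) (rootDeltaChar t.P)) hπ).trans
        (normalizedJacquetHomEquiv t π (π.normalizedJacquet t) hδ)).symm (IntertwiningMap.id (π.normalizedJacquet t))) =
      IntertwiningMap.id (π.normalizedJacquet t) :=
  LinearEquiv.apply_symm_apply _ _

/-- **`η v = 0 ⟺ ∀ g, [π(g) v] = 0`**: the kernel of the unit is the largest subrepresentation of `π` inside the kernel `V(N)` of `V → V_N`.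
[cite: BernsteinZelevinsky1977, §1.9] [cite: Casselman1995, §3.2] -/
theorem mem_ker_unit_iff (hπ : π.IsSmooth)
    (hδ : ∀ (n : G) (hn : n ∈ t.N), deltaChar t.P ⟨n, t.N_le hn⟩ = 1) (v : V) :
    v ∈ (((frobeniusEquiv (H := t.P) (σ := Representation.twist ((π.normalizedJacquet t).comp t.proj) (rootDeltaChar t.P)) hπ).trans
        (normalizedJacquetHomEquiv t π (π.normalizedJacquet t) hδ)).symm (IntertwiningMap.id (π.normalizedJacquet t))).ker ↔
      ∀ g : G, Coinvariants.mk (t.restrict π) (π g v) = 0 :=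
  mem_ker_iff_forall_mk_eq_zero t (π.normalizedJacquet t) hπ hδ _
    (by rw [adjoint_unit]; exact fun x y h => h) v

/-- **`r_P(η)` is injective** (split by the counit, §2; no exactness used). [cite: BernsteinZelevinsky1977, Proposition 1.9(b), p. 445] [cite: Casselman1995, Thm. 3.2.4] -/
theorem jacquetMap_unit_injective (hπ : π.IsSmooth)
    (hδ : ∀ (n : G) (hn : n ∈ t.N), deltaChar t.P ⟨n, t.N_le hn⟩ = 1) :
    Function.Injective (jacquetMap t
      (((frobeniusEquiv (H := t.P) (σ := Representation.twist ((π.normalizedJacquet t).comp t.proj) (rootDeltaChar t.P)) hπ).trans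
        (normalizedJacquetHomEquiv t π (π.normalizedJacquet t) hδ)).symm (IntertwiningMap.id (π.normalizedJacquet t)))) :=
  jacquetMap_injective_of_adjoint_injective t (π.normalizedJacquet t) hπ hδ _ (by rw [adjoint_unit]; exact fun x y h => h)

/-- **«THE KERNEL OF THE FROBENIUS UNIT IS `r_P`-NULL»**: for `π` smooth and `N` the union of its compact open subgroups, the Jacquet module of the subrepresentation
`ker η` is zero. [cite: BernsteinZelevinsky1977, Prop. 1.9 (a)–(b), p. 445] [cite: Casselman1995, Prop. 3.2.3, Thm. 3.2.4] -/
theorem mk_ker_unit_eq_zero (hN : IsLimitOfCompactOpen t.N) (hπ : π.IsSmooth)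
    (hδ : ∀ (n : G) (hn : n ∈ t.N), deltaChar t.P ⟨n, t.N_le hn⟩ = 1)
    (w : ↥(((frobeniusEquiv (H := t.P) (σ := Representation.twist ((π.normalizedJacquet t).comp t.proj) (rootDeltaChar t.P)) hπ).trans
        (normalizedJacquetHomEquiv t π (π.normalizedJacquet t) hδ)).symm (IntertwiningMap.id (π.normalizedJacquet t))).ker.toSubmodule) :
    Coinvariants.mk (t.restrict
      (((frobeniusEquiv (H := t.P) (σ := Representation.twist ((π.normalizedJacquet t).comp t.proj) (rootDeltaChar t.P)) hπ).trans
        (normalizedJacquetHomEquiv t π (π.normalizedJacquet t) hδ)).symm (IntertwiningMap.id (π.normalizedJacquet t))).ker.toRepresentation) w = 0 :=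
  mk_ker_eq_zero t (π.normalizedJacquet t) hN hπ hδ _ (by rw [adjoint_unit]; exact fun x y h => h) w

/-- **The unit `η : π → i_P^G(r_P π)` is INJECTIVE when every non-zero subrepresentation of `π` has a non-zero Jacquet class** (`π` smooth, `N` the union of its compact open
subgroups) — «`E ≅ η(E) ⊂ i_P^G(r_P E)`». [cite: BernsteinZelevinsky1977, Prop. 1.9 (a)–(b), p. 445] [cite: Casselman1995, Prop. 3.2.3, Thm. 3.2.4] -/
theorem unit_injective_of_forall_exists_mk_ne_zero (hN : IsLimitOfCompactOpen t.N) (hπ : π.IsSmooth)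
    (hδ : ∀ (n : G) (hn : n ∈ t.N), deltaChar t.P ⟨n, t.N_le hn⟩ = 1)
    (hfaith : ∀ U : Subrepresentation π, U ≠ ⊥ → ∃ w : ↥U.toSubmodule, Coinvariants.mk (t.restrict U.toRepresentation) w ≠ 0) :
    Function.Injective
      (((frobeniusEquiv (H := t.P) (σ := Representation.twist ((π.normalizedJacquet t).comp t.proj) (rootDeltaChar t.P)) hπ).trans
        (normalizedJacquetHomEquiv t π (π.normalizedJacquet t) hδ)).symm (IntertwiningMap.id (π.normalizedJacquet t))) :=
  injective_of_forall_exists_mk_ne_zero t (π.normalizedJacquet t) hN hπ hδ _ (by rw [adjoint_unit]; exact fun x y h => h) hfaith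

end Unit

end Representation

end
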